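import Summits.SmoothPoincare4.SmoothPoincare4.Theorems.CylinderEntropyCylinderRungTwoSliceOfAreaEqFloor
import Summits.SmoothPoincare4.SmoothPoincare4.Theorems.CylinderEntropyCylinderRungTwoFiniteTimeHalfOfCrux
import Summits.SmoothPoincare4.SmoothPoincare4.Theorems.CylinderEntropyCylinderRungTwoKillingFluxDefs
import Literature.Geometry.Riemannian.SphericalCylinderEntropy
import Literature.Geometry.Manifold.CylinderSlice
import HarnessLib

/-!
# Route `CylinderEntropy`, crux `CylinderRungTwo` (stmt-SmoothPoincare4-7631), line `killing-flux`:
# RIGIDITY OF RUNG ONE — a separating connected cross-section with `λ_cyl ≤ 1` is a slice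

Registered helper `helper_sliceOfCylEntropyLeOne` (lead c6, rigidity layer R3-I), closing the c6 rigidity layer of the ladder:
for a compact connected smoothly embedded cross-section `ι : M → N = S⁴ × ℝ ⊂ ℝ⁶` separating the two ends and carrying a
continuous unit normal field `ν` tangent to `N`, the inequality `λ_cyl(ι M) ≤ 1` forces `ι(M)` to be a slice `S⁴ × {c}`.
Proof: the large-scale end of the typed entropy (`measure_ratio_le_cylEntropy`: `μH⁴(ι M)/μH⁴(S⁴) ≤ λ_cyl ≤ 1`) and the
AREA FLOOR of separating sets (`hausdorffMeasure_sphere_le_of_separatesEnds`: `μH⁴(S⁴) ≤ μH⁴(ι M)`) give `μH⁴(ι M) = μH⁴(S⁴)`, and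
the equality case of the area floor (`helper_sliceOfAreaEqFloor`, landed: flux identity ⇒ `|ν₅| ≡ 1` ⇒ constant height ⇒ slice)
concludes.  Together with the landed calibration `λ_cyl(S⁴ × {c}) = 1` (`cylEntropy_range_sliceMap_le_one`,
`one_le_cylEntropy_slice`) this is the RIGIDITY OF RUNG ONE, `cylEntropy_eq_one_iff_slice`: among separating connected
cross-sections, `λ_cyl = 1` exactly for the slices — the equality case that the route crux `SliceIsolation` (stmt-7632) quantifies.
(With the sibling files `…MinimalIsSlice.lean` and
`…TranslatorIsMinimal.lean`: the only compact minimal, static or `e₅`-translating cross-sections of `N` are the slices.)  Everything is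
PROVED (no `sorry`, no definition, no named fact).

References: T. H. Colding, W. P. Minicozzi II, *Generic mean curvature flow I*, Ann. of Math. 175 (2012), §1 (entropy ≥ density
ratios; planes/self-shrinkers as equality cases); R. S. Hamilton, Comm. Anal. Geom. 1 (1993) 127–137 (the kernel).
-/

noncomputable section

-- the prescribed namespace `Summit.SmoothPoincare4.SmoothPoincare4.…` repeats `SmoothPoincare4`
set_option linter.dupNamespace false

open MeasureTheory Set
open scoped Manifold ContDiff ENNReal Topology BigOperators

namespace Summit.SmoothPoincare4.SmoothPoincare4.Cruxes.CylinderRungTwo.KillingFlux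

open Literature.Geometry.Riemannian
open Literature.Geometry.Lorentzian Literature.Geometry.Lorentzian.PseudoRiemannianMetric
open Literature.Geometry.Riemannian.SphericalCylinderEntropy
open Literature.Geometry.Manifold.CylinderSlice

/-- From `v⁻¹ * m ≤ 1` with `v ≠ 0, ⊤` conclude `m ≤ v` (in `ℝ≥0∞`). [folklore] -/
theorem le_of_inv_mul_le_one {v m : ℝ≥0∞} (hv0 : v ≠ 0) (hvt : v ≠ ⊤) (h : v⁻¹ * m ≤ 1) : m ≤ v := by
  calc m = v * (v⁻¹ * m) := by rw [← mul_assoc, ENNReal.mul_inv_cancel hv0 hvt, one_mul]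
    _ ≤ v * 1 := by gcongr
    _ = v := mul_one v

/-- **Registered helper `helper_sliceOfCylEntropyLeOne` — RIGIDITY OF RUNG ONE.**  A compact connected smoothly embedded
cross-section of `N` separating the ends, with a continuous unit normal field tangent to `N`, and with typed cylinder entropy
`λ_cyl ≤ 1`, is a slice `S⁴ × {c}`: `area/vol ≤ λ_cyl ≤ 1` and the area floor give `area = vol`, and the equality case of the area
floor (`helper_sliceOfAreaEqFloor`) applies. [cite: ColdingMinicozzi2012, §1] -/
theorem helper_sliceOfCylEntropyLeOne :
    ∀ (M : Type) [TopologicalSpace M] [T2Space M] [SecondCountableTopology M]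
      [ChartedSpace (EuclideanSpace ℝ (Fin 4)) M] [IsManifold (𝓡 4) ∞ M] [CompactSpace M] [ConnectedSpace M]
      [MeasurableSpace M] [BorelSpace M]
      (ι : M → EuclideanSpace ℝ (Fin 6)), Manifold.IsSmoothEmbedding (𝓡 4) (𝓡 6) ∞ ι →
      (∀ x, ∑ i : Fin 5, ι x (Fin.castSucc i) ^ 2 = 1) →
      (∃ R : ℝ, ∀ a b : EuclideanSpace ℝ (Fin 6), ∑ i : Fin 5, a (Fin.castSucc i) ^ 2 = 1 →
        ∑ i : Fin 5, b (Fin.castSucc i) ^ 2 = 1 → a 5 ≤ -R → R ≤ b 5 →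
        ¬ JoinedIn ({z : EuclideanSpace ℝ (Fin 6) | ∑ i : Fin 5, z (Fin.castSucc i) ^ 2 = 1} \ Set.range ι) a b) →
      ∀ ν : M → EuclideanSpace ℝ (Fin 6), Continuous ν →
        (Literature.Geometry.Riemannian.euclideanMetric (EuclideanSpace ℝ (Fin 6))).IsUnitNormal (𝓡 4) ι ν 1 →
        (∀ x, ∑ i : Fin 5, ν x (Fin.castSucc i) * ι x (Fin.castSucc i) = 0) →
        Literature.Geometry.Riemannian.SphericalCylinderEntropy.cylEntropy (Set.range ι) ≤ 1 →
        ∃ c : ℝ, Set.range ι = Set.range (Literature.Geometry.Manifold.CylinderSlice.sliceMap c) := by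
  intro M _ _ _ _ _ _ _ _ _ ι hι hN hsep ν hνc hνn hνN hent
  set v : ℝ≥0∞ := μH[4] (Metric.sphere (0 : EuclideanSpace ℝ (Fin 5)) 1) with hv
  have hv0 : v ≠ 0 := hausdorffMeasure_sphere_four_pos.ne'
  have hvt : v ≠ ⊤ := hausdorffMeasure_sphere_four_lt_top.ne
  -- the cross-section: compact, hence measurable and of bounded height, inside `N`
  have hcpt : IsCompact (Set.range ι) := isCompact_range hι.isEmbedding.continuous
  have hAm : MeasurableSet (Set.range ι) := hcpt.isClosed.measurableSet
  have hAN : ∀ z ∈ Set.range ι, ∑ i : Fin 5, z (Fin.castSucc i) ^ 2 = 1 := by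
    rintro _ ⟨x, rfl⟩
    exact hN x
  obtain ⟨B, hB⟩ := hcpt.isBounded.exists_norm_le
  have hB' : ∀ z ∈ Set.range ι, |z 5| ≤ B := fun z hz =>
    le_trans (by simpa [Real.norm_eq_abs] using PiLp.norm_apply_le z 5) (hB z hz)
  -- `area ≤ vol` from `area/vol ≤ λ_cyl ≤ 1`
  have hle : μH[4] (Set.range ι) ≤ v :=
    le_of_inv_mul_le_one hv0 hvt ((measure_ratio_le_cylEntropy hAm hAN hB').trans hent)
  -- `vol ≤ area` from separation (the area floor)
  obtain ⟨R, hR⟩ := hsep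
  have hge : v ≤ μH[4] (Set.range ι) := hausdorffMeasure_sphere_le_of_separatesEnds hR
  -- equality case of the area floor
  exact helper_sliceOfAreaEqFloor M ι hι hN ⟨R, hR⟩ ν hνc hνn hνN (le_antisymm hle hge)

/-- **Rigidity of rung one** (both directions): a compact connected smoothly embedded separating cross-section of `N` with a
continuous unit normal field tangent to `N` has `λ_cyl = 1` if and only if it is a slice `S⁴ × {c}` — `⇒` by
`helper_sliceOfCylEntropyLeOne`, `⇐` by the landed calibration of slices (`cylEntropy_range_sliceMap_le_one`,
`one_le_cylEntropy_slice`). [cite: ColdingMinicozzi2012, §1] -/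
theorem cylEntropy_eq_one_iff_slice {M : Type} [TopologicalSpace M] [T2Space M] [SecondCountableTopology M]
    [ChartedSpace (EuclideanSpace ℝ (Fin 4)) M] [IsManifold (𝓡 4) ∞ M] [CompactSpace M] [ConnectedSpace M]
    [MeasurableSpace M] [BorelSpace M] {ι : M → EuclideanSpace ℝ (Fin 6)}
    (hι : Manifold.IsSmoothEmbedding (𝓡 4) (𝓡 6) ∞ ι) (hN : ∀ x, ∑ i : Fin 5, ι x (Fin.castSucc i) ^ 2 = 1)
    (hsep : ∃ R : ℝ, ∀ a b : EuclideanSpace ℝ (Fin 6), ∑ i : Fin 5, a (Fin.castSucc i) ^ 2 = 1 →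
      ∑ i : Fin 5, b (Fin.castSucc i) ^ 2 = 1 → a 5 ≤ -R → R ≤ b 5 →
      ¬ JoinedIn ({z : EuclideanSpace ℝ (Fin 6) | ∑ i : Fin 5, z (Fin.castSucc i) ^ 2 = 1} \ Set.range ι) a b)
    {ν : M → EuclideanSpace ℝ (Fin 6)} (hνc : Continuous ν)
    (hνn : (euclideanMetric (EuclideanSpace ℝ (Fin 6))).IsUnitNormal (𝓡 4) ι ν 1)
    (hνN : ∀ x, ∑ i : Fin 5, ν x (Fin.castSucc i) * ι x (Fin.castSucc i) = 0) :
    cylEntropy (Set.range ι) = 1 ↔ ∃ c : ℝ, Set.range ι = Set.range (sliceMap c) := by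
  constructor
  · intro h
    exact helper_sliceOfCylEntropyLeOne M ι hι hN hsep ν hνc hνn hνN h.le
  · rintro ⟨c, hc⟩
    rw [hc]
    exact le_antisymm (FiniteTimeHalfOfCrux.cylEntropy_range_sliceMap_le_one c) (one_le_cylEntropy_slice c)

end Summit.SmoothPoincare4.SmoothPoincare4.Cruxes.CylinderRungTwo.KillingFlux

end
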